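import Literature.NumberTheory.EllipticCurves.HeegnerPointsKolyvaginPrimaryCebotarevProofs
import Literature.NumberTheory.EllipticCurves.HeegnerPointsKolyvaginPrimaryCongruenceProofs
import Literature.NumberTheory.EllipticCurves.ModPImageDivisionPolynomialCriterionProofs
import Literature.NumberTheory.EllipticCurves.MazurRubin2010.TwistSelmerRankControl
import Summits.BirchSwinnertonDyer.BirchSwinnertonDyer.Theorems.CMKolyvaginAtInertTwoRestrictionInjectiveAtTwo
import Summits.BirchSwinnertonDyer.BirchSwinnertonDyer.Theorems.CMKolyvaginAtInertTwoConjugationTypeAtTwo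
import Summits.BirchSwinnertonDyer.BirchSwinnertonDyer.Theorems.KolyvaginRoadThreeZhangSupplyLocalConj
import Mathlib.NumberTheory.Padics.HeightOneSpectrum
import HarnessLib

/-!
# Route `GenusKolyvaginAtTwo`, crux #2 `GenusPrimitiveSupplyAtTwo` (stmt-BirchSwinnertonDyer-22136):
# twisting primes at `2` — the LOCAL and IMAGE ingredients over `ℚ`

Width seat `bsd-line-gk2-p4` g7, cell `bsd-f1-sign2`; helper (`--supports stmt-BirchSwinnertonDyer-22136`),
first of two files. THEOREMS ONLY: no definition, no named fact, no `sorry`; no item is closed; BSD is not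
proved by any of this. The companion file `…GenusPrimitiveSupplyAtTwoTwistingPrime.lean` assembles these
ingredients with the (proved) Čebotarev density theorem into the existence of Mazur–Rubin twisting primes
at `2` — the «one missing print input for SUPPLY″ on WALL row 1» of the line memo
`Cruxes/GenusPrimitiveSupplyAtTwo/Lines/genus-supply-prime-heegner.md` (seat gk2-p5 g6), as a theorem.

## Contents (all proved, standard axioms)

* §1 Image algebra over `ℚ` at level `2` (`ρ̄_{W,2}` onto): an element of `Γ_ℚ` of order `3`
  without fixed points on `E[2]` (`exists_smul_three_rat`); Gross's Prop. 9.1 at `2` over `ℚ`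
  (`h1_restriction_injective_two_rat`, from the tree's `KolyvaginImageTwo.eq_zero_of_h1Eval_eq_zero_two`,
  Lawson–Wuthrich Lemma 6); no non-zero `Γ_ℚ`-fixed `2`-torsion (`eq_zero_of_forall_smul_eq`);
  commutators of `Γ_ℚ` fix roots of unity; and the KEY LEMMA `exists_torsionFixing_smul_h1Eval_ne`:
  for `x ≠ 0` in `H¹(ℚ, E[2])`, `Δ(W) < 0` and a root of unity `ζ`, some `h ∈ Γ_{ℚ(E[2], ζ)}` has
  `c₀ [x, h] ≠ [x, h]` (complex conjugation `c₀` moves the value of the restricted cocycle).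
* §2 The easy half of the local criterion (Gross 1991 Prop. 9.6 / McCallum 1991 §3 (3)) for ANY
  element of the decomposition group acting trivially on `E[n]` (`h1Eval_eq_zero_of_mem_torsionLocalKer`),
  and its use at the SQUARE of a Frobenius (`not_mem_torsionLocalKer_of_h1Eval_sq_ne_zero`): over a
  general number field `K`, no unramifiedness or reduction hypothesis.
* §3 Places of `ℚ`: `χ_cyc(Frob_v) = N v` on `μ_m` for `v ∤ m` (Mathlib `IsArithFrobAt.apply_of_pow_eq_one`),
  Mathlib's generator `primesEquiv v` of `v ∩ ℤ`, and the transport of the strict local condition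
  `ker (H¹(ℚ,E[n]) → H¹(E,E[n]))` along a ring isomorphism `E ≃+* ℚ_ℓ` (tree `conjAct_mem_torsionLocalKer_iff`
  at `σ = 1`), stated with an IMPLICIT `Algebra ℚ E` binder: the adic completion `v.adicCompletion ℚ` carries
  two non-defeq `ℚ`-algebra structures (`instAlgebraAdicCompletion` and `DivisionRing.toRatAlgebra`), and the
  general-`K` lemmas of the tree use the former — consumers must never re-synthesise it.

Not here: the Čebotarev step and the statement in Mazur–Rubin's currency (companion file); nothing about
Heegner points, `M₀`, or W. Zhang's theorem at `2`.

References: [MazurRubin2010] §3 (Prop. 3.3, Lemma 3.5); [GrossLMS1991] §9 (Prop. 9.1, 9.6);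
[McCallumLMS1991] §3 (2), (3), Cor. 3.2; [LawsonWuthrich2016] Lemma 6; [SerreAbelianLadic1968] I §1.2, §2.2.
-/

set_option linter.dupNamespace false -- tree convention: `Summit.BirchSwinnertonDyer.BirchSwinnertonDyer.Theorems` (summit = sub-problem)
set_option autoImplicit false

noncomputable section

open scoped Classical Pointwise

namespace Summit.BirchSwinnertonDyer.BirchSwinnertonDyer.Theorems.GenusKolyTwistingPrime

open WeierstrassCurve NumberField IsDedekindDomain Field
open Literature.NumberTheory.GaloisRepresentations Literature.NumberTheory.EllipticCurves
open Literature.NumberTheory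

/-! ## §1 Image algebra over `ℚ` at level `2` -/

section Image

variable (W : WeierstrassCurve ℚ) [W.IsElliptic]

/-- `#E(ℚ̄)[2] = 4`. [cite: SilvermanAEC2009, Cor. III.6.4(b)] -/
theorem natCard_geomTorsion_two_rat :
    Nat.card (geomTorsion W (2 : ℤ)) = 4 := by
  have h : Nat.card (geomTorsion W ((2 : ℕ) : ℤ)) = 2 ^ 2 :=
    card_torsionPoints_eq_sq_holds W (AlgebraicClosure ℚ) (n := 2) (by norm_num)
  exact h

/-- **An element of `Γ_ℚ` acting on `E[2]` with order `3` and no non-zero fixed point**, for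
`W/ℚ` with `ρ̄_{W,2}` onto (realise the square of a `3`-cycle of `Aut E[2] ≅ S₃`).
[cite: LawsonWuthrich2016, Lemma 6] [cite: GrossLMS1991, §9 (before Prop. 9.1)] -/
theorem exists_smul_three_rat (hsurj : W.HasSurjectiveModNGaloisRep 2) :
    ∃ z : absoluteGaloisGroup ℚ,
      (∀ P : geomTorsion W (2 : ℤ), z • z • z • P = P) ∧
      (∀ P : geomTorsion W (2 : ℤ), z • P = P → P = 0) := by
  have hT : ∀ P : geomTorsion W (2 : ℤ), 2 • P = 0 := fun P ↦
    AddSubgroup.torsionBy.nsmul P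
  have hcard : Nat.card (geomTorsion W (2 : ℤ)) = 2 ^ 2 := natCard_geomTorsion_two_rat W
  obtain ⟨eT⟩ := KolyvaginImage.nonempty_addEquiv_of_card_eq_sq hT hcard
  refine KolyvaginImageTwo.exists_smul_three eT fun A ↦ ?_
  obtain ⟨γ, hγ⟩ := hsurj (Multiplicative.ofAdd (A.trans A))
  refine ⟨γ, fun t ↦ ?_⟩
  have h := galoisRepTorsion_apply W (2 : ℤ) γ t
  rw [hγ, toAdd_ofAdd] at h
  rw [← h]
  rfl

/-- **Gross's Prop. 9.1 at `p = 2` over `ℚ`: restriction `H¹(ℚ, E[2]) → Hom(Γ_{ℚ(E[2])}, E[2])` is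
injective** when `ρ̄_{W,2}` is onto (`H¹(GL₂(𝔽₂), 𝔽₂²) = 0`; the element of order `3` replaces the
homothety `−1`). [cite: LawsonWuthrich2016, Lemma 6] [cite: GrossLMS1991, §9 Prop. 9.1] -/
theorem h1_restriction_injective_two_rat (hsurj : W.HasSurjectiveModNGaloisRep 2)
    {x : galH1Torsion W (2 : ℤ)}
    (hx : ∀ ρ ∈ torsionFixing W (2 : ℤ), h1Eval W (2 : ℤ) x ρ = 0) : x = 0 := by
  obtain ⟨z, -, hzfix⟩ := exists_smul_three_rat W hsurj
  exact KolyvaginImageTwo.eq_zero_of_h1Eval_eq_zero_two W (natCard_geomTorsion_two_rat W) hzfix hx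

/-- **No non-zero `Γ_ℚ`-fixed point of `E[2]`** when `ρ̄_{W,2}` is onto (`Γ_ℚ` is transitive on
`E[2] ∖ O`, which has three elements). [cite: Serre1972, §2.1] -/
theorem eq_zero_of_forall_smul_eq (hsurj : W.HasSurjectiveModNGaloisRep 2)
    {P : geomTorsion W (2 : ℤ)} (hP : ∀ σ : absoluteGaloisGroup ℚ, σ • P = P) : P = 0 := by
  by_contra hP0
  have hsurj' : W.HasSurjectiveModNGaloisRep ((2 : ℕ) : ℤ) := by simpa using hsurj
  have h2Q : ((2 : ℕ) : ℚ) ≠ 0 := by norm_num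
  have hall : ∀ Q : geomTorsion W (2 : ℤ), Q ≠ 0 → Q = P := fun Q hQ ↦ by
    obtain ⟨σ, hσ⟩ := exists_smul_eq_of_hasSurjectiveModNGaloisRep W 2 h2Q hsurj' hP0 hQ
    rw [← hσ, hP]
  have hT : ∀ Q : geomTorsion W (2 : ℤ), 2 • Q = 0 := fun Q ↦ AddSubgroup.torsionBy.nsmul Q
  have hcard : Nat.card (geomTorsion W (2 : ℤ)) = 2 ^ 2 := natCard_geomTorsion_two_rat W
  obtain ⟨eT⟩ := KolyvaginImage.nonempty_addEquiv_of_card_eq_sq hT hcard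
  set a : geomTorsion W (2 : ℤ) := eT.symm (Pi.single 0 1) with ha
  set b : geomTorsion W (2 : ℤ) := eT.symm (Pi.single 1 1) with hb
  have h10 : (Pi.single 0 1 : Fin 2 → ZMod 2) ≠ 0 := by
    intro h; have := congrFun h 0; simp at this
  have h11 : (Pi.single 1 1 : Fin 2 → ZMod 2) ≠ 0 := by
    intro h; have := congrFun h 1; simp at this
  have h01 : (Pi.single 0 1 : Fin 2 → ZMod 2) ≠ Pi.single 1 1 := by
    intro h; have := congrFun h 0; simp at this
  have ha0 : a ≠ 0 := fun h ↦ h10 (eT.symm.injective (by rw [← ha, h, map_zero]))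
  have hb0 : b ≠ 0 := fun h ↦ h11 (eT.symm.injective (by rw [← hb, h, map_zero]))
  have hab : a ≠ b := fun h ↦ h01 (eT.symm.injective (by rw [← ha, ← hb, h]))
  exact hab ((hall a ha0).trans (hall b hb0).symm)

/-- Two elements of `Γ_ℚ` commute on a root of unity (both act on `μ_m` by raising to a power).
[folklore] -/
theorem mul_smul_rootOfUnity_comm {m : ℕ} [NeZero m] {ζ : AlgebraicClosure ℚ}
    (hζ : IsPrimitiveRoot ζ m) (γ δ : absoluteGaloisGroup ℚ) : (γ * δ) • ζ = (δ * γ) • ζ := by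
  have hpow : ∀ σ : absoluteGaloisGroup ℚ, ∃ i : ℕ, σ • ζ = ζ ^ i := fun σ ↦ by
    have h1 : (σ • ζ) ^ m = 1 := by rw [← smul_pow', hζ.pow_eq_one, smul_one]
    obtain ⟨i, -, hi⟩ := hζ.eq_pow_of_pow_eq_one h1
    exact ⟨i, hi.symm⟩
  obtain ⟨a, ha⟩ := hpow γ
  obtain ⟨b, hb⟩ := hpow δ
  rw [mul_smul, mul_smul, hb, smul_pow', ha, smul_pow', hb, ← pow_mul, ← pow_mul, mul_comm]

/-- The stabiliser of a root of unity contains every commutator of `Γ_ℚ` (`Gal(ℚ(μ_m)/ℚ)` is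
abelian). [folklore] -/
theorem commutator_smul_rootOfUnity {m : ℕ} [NeZero m] {ζ : AlgebraicClosure ℚ}
    (hζ : IsPrimitiveRoot ζ m) (γ δ : absoluteGaloisGroup ℚ) : (γ * δ * γ⁻¹ * δ⁻¹) • ζ = ζ := by
  have h := mul_smul_rootOfUnity_comm hζ γ⁻¹ δ⁻¹
  have e : γ * δ * γ⁻¹ * δ⁻¹ = (γ * δ) * (δ * γ)⁻¹ := by group
  rw [e, mul_smul, mul_inv_rev, h, ← mul_smul]
  have e' : γ * δ * (δ⁻¹ * γ⁻¹) = 1 := by group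
  rw [e', one_smul]

/-- **KEY LEMMA.** For `x ≠ 0` in `H¹(ℚ, E[2])` (`ρ̄_{W,2}` onto, `Δ_W < 0`), a complex conjugation
`c₀` and a root of unity `ζ`: some `h ∈ Γ_{ℚ(E[2])}` fixing `ζ` has `c₀ • [x, h] ≠ [x, h]`. (The values
`[x, h]`, `h ∈ Γ_{ℚ(E[2], ζ)}`, form a `Γ_ℚ`-stable subgroup of `E[2]`; it is non-zero — else every
`[x, ρ]`, `ρ ∈ Γ_{ℚ(E[2])}`, is `Γ_ℚ`-fixed (commutators lie in `Γ_{ℚ(E[2], ζ)}`), hence `0`, hence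
`x = 0` by Prop. 9.1 at `2` — so it is all of `E[2]` by transitivity, and `c₀` moves a `2`-torsion
point when `Δ < 0`.) [cite: MazurRubin2010, Lemma 3.5 and Prop. 3.3 (choice of twisting primes)]
[cite: GrossLMS1991, §9 Prop. 9.1] -/
theorem exists_torsionFixing_smul_h1Eval_ne (hsurj : W.HasSurjectiveModNGaloisRep 2)
    (hΔ : W.Δ < 0) {c₀ : absoluteGaloisGroup ℚ} (hc₀ : IsComplexConjugation (Rat.castHom ℝ) c₀)
    {x : galH1Torsion W (2 : ℤ)} (hx : x ≠ 0) {m : ℕ} [NeZero m] {ζ : AlgebraicClosure ℚ}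
    (hζ : IsPrimitiveRoot ζ m) :
    ∃ h ∈ torsionFixing W (2 : ℤ), h • ζ = ζ ∧
      c₀ • h1Eval W (2 : ℤ) x h ≠ h1Eval W (2 : ℤ) x h := by
  have hpow : ∀ σ : absoluteGaloisGroup ℚ, ∃ i : ℕ, σ • ζ = ζ ^ i := fun σ ↦ by
    have h1 : (σ • ζ) ^ m = 1 := by rw [← smul_pow', hζ.pow_eq_one, smul_one]
    obtain ⟨i, -, hi⟩ := hζ.eq_pow_of_pow_eq_one h1
    exact ⟨i, hi.symm⟩
  -- conjugates of `ζ`-fixing elements fix `ζ`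
  have hconj : ∀ σ h : absoluteGaloisGroup ℚ, h • ζ = ζ → (σ * h * σ⁻¹) • ζ = ζ := by
    intro σ h hh
    obtain ⟨i, hi⟩ := hpow σ⁻¹
    rw [mul_smul, mul_smul, hi, smul_pow', hh, ← hi, smul_inv_smul]
  -- Step 1: some `h ∈ Γ_{ℚ(E[2], ζ)}` has `[x, h] ≠ 0`
  have step1 : ∃ h ∈ torsionFixing W (2 : ℤ), h • ζ = ζ ∧ h1Eval W (2 : ℤ) x h ≠ 0 := by
    by_contra hcon
    push Not at hcon
    apply hx
    apply h1_restriction_injective_two_rat W hsurj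
    intro ρ hρ
    apply eq_zero_of_forall_smul_eq W hsurj
    intro γ
    have hc1 : γ * ρ * γ⁻¹ ∈ torsionFixing W (2 : ℤ) := (torsionFixing_normal W _).conj_mem ρ hρ γ
    have hcomm_fix : γ * ρ * γ⁻¹ * ρ⁻¹ ∈ torsionFixing W (2 : ℤ) := mul_mem hc1 (inv_mem hρ)
    have hcomm_ζ : (γ * ρ * γ⁻¹ * ρ⁻¹) • ζ = ζ := commutator_smul_rootOfUnity hζ γ ρ
    have h0 := hcon _ hcomm_fix hcomm_ζ
    rw [h1Eval_mul W _ x hc1, h1Eval_conj W _ x γ hρ, h1Eval_inv W _ x hρ, add_neg_eq_zero] at h0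
    exact h0
  -- Step 2: `c₀` cannot fix every value
  by_contra hcon
  push Not at hcon
  obtain ⟨h₁, hh₁, hζ₁, hv₁⟩ := step1
  obtain ⟨v, hv⟩ : ∃ v : geomTorsion W (2 : ℤ), c₀ • v ≠ v :=
    KolyvaginEigenTwo.exists_twoTorsion_smul_ne_of_Δ_neg W hΔ hc₀
  apply hv
  by_cases hv0 : v = 0
  · rw [hv0, smul_zero]
  have hsurj' : W.HasSurjectiveModNGaloisRep ((2 : ℕ) : ℤ) := by simpa using hsurj
  have h2Q : ((2 : ℕ) : ℚ) ≠ 0 := by norm_num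
  obtain ⟨σ, hσ⟩ := exists_smul_eq_of_hasSurjectiveModNGaloisRep W 2 h2Q hsurj' hv₁ hv0
  have hmem : σ * h₁ * σ⁻¹ ∈ torsionFixing W (2 : ℤ) := (torsionFixing_normal W _).conj_mem h₁ hh₁ σ
  have hfix := hcon _ hmem (hconj σ h₁ hζ₁)
  rwa [h1Eval_conj W _ x σ hh₁, hσ] at hfix

end Image

/-! ## §2 The easy half of the local criterion, for any torsion-fixing element of the decomposition group -/

section Local

universe u

variable {K : Type u} [Field K] [NumberField K] (W : WeierstrassCurve K) {v : HeightOneSpectrum (𝓞 K)}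

/-- **If `x_v = 0` in `H¹(K_v, E[n])` then `[x, ρ] = 0` for every `ρ` in the decomposition group
`G_𝔓` (of the prime `𝔓` of `\bar ℤ_K` cut out by the chosen embedding `K̄ → K̄_v`) acting trivially
on `E[n]`** — the (⟹) half of Gross 1991 Prop. 9.6 / McCallum 1991 §3 (3), which needs neither a
Frobenius nor unramifiedness: lift `ρ` to `σ ∈ Γ_{K_v}` (local–global principle for decomposition
groups) and evaluate the local coboundary `g ↦ gQ − Q` at `σ`, where `σQ = Q` because `σ` acts on
`E(K̄_v)[n] = E(K̄)[n]` through `ρ`. Used below at `ρ = Frob²`, which acts trivially on `E[2]`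
when `Frob` acts as a transposition. [cite: GrossLMS1991, Prop. 9.6] [cite: McCallumLMS1991, §3 (3)] -/
theorem h1Eval_eq_zero_of_mem_torsionLocalKer (n : ℤ)
    {𝔐 : Ideal (HeightOneSpectrum.localAbsIntegers v)} (h𝔐 : 𝔐 ∈ v.localPrimesAbove)
    {ρ : absoluteGaloisGroup K}
    (hρ : ρ ∈ (v.primeBelow (closureEmb (K := K) (v.adicCompletion K)) 𝔐).decompositionSubgroup
      (absoluteGaloisGroup K))
    (hρfix : ρ ∈ torsionFixing W n)
    (hsurj : Function.Surjective (torsionPointsMap W (v.adicCompletion K) n))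
    {x : galH1Torsion W n} (hx : x ∈ W.torsionLocalKer (v.adicCompletion K) n) :
    h1Eval W n x ρ = 0 := by
  set ι₀ := closureEmb (K := K) (v.adicCompletion K) with hι₀
  set φ := reprCocycle W n x with hφ
  have hclass : oneCocycleClass _ φ = x := oneCocycleClass_reprCocycle W n x
  have hinj := torsionPointsMap_injective W (v.adicCompletion K) n
  have hker : x ∈ W.torsionLocalKer (v.adicCompletion K) n ↔
      ∃ Q : AddSubgroup.torsionBy (localPoints W (v.adicCompletion K)) n,
        ∀ g : absoluteGaloisGroup (v.adicCompletion K),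
          torsionPointsMap W (v.adicCompletion K) n
            (φ.1 (resGal (K := K) (v.adicCompletion K) g)) = g • Q - Q := by
    rw [← hclass]
    exact oneCocycleClass_mem_resKer_iff _ _ _ φ
  obtain ⟨Q, hQ⟩ := hker.mp hx
  obtain ⟨σ, hσ⟩ := exists_apply_eq_smul_of_mem_decompositionSubgroup ι₀ h𝔐 hρ
  have hres : resGal (K := K) (v.adicCompletion K) σ = ρ := by
    rw [resGal_eq]; exact resGalOfEmb_eq_of_apply_eq ι₀ hσ
  have hσQ : σ • Q = Q := by
    obtain ⟨P, rfl⟩ := hsurj Q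
    rw [← torsionPointsMap_smul, hres, smul_eq_of_mem_torsionFixing W n hρfix]
  have h := hQ σ
  rw [hres, hσQ, sub_self, ← map_zero (torsionPointsMap W (v.adicCompletion K) n)] at h
  exact hinj h

/-- **`x_v ≠ 0` from a Frobenius whose SQUARE acts trivially on `E[n]` with `[x, Frob²] ≠ 0`.**
For a finite place `v` of `K`, an arithmetic Frobenius `γ` at some prime of `\bar ℤ_K` above `v`
with `γ² ∈ Γ_{K(E[n])}` and `[x, γ²] ≠ 0`, the class `x ∈ H¹(K, E[n])` does not die in
`H¹(K_v, E[n])`: conjugate `γ` to a Frobenius `F` at the prime cut out by the chosen embedding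
`K̄ → K̄_v` (`exists_isArithFrobAt_conj_of_mem_primesAbove_holds`); `F² ∈ G_𝔓 ∩ Γ_{K(E[n])}` and
`[x, F²]` is a `Γ_K`-translate of `[x, γ²] ≠ 0`, contradicting `h1Eval_eq_zero_of_mem_torsionLocalKer`.
No unramifiedness or reduction hypothesis at `v` is needed. [cite: GrossLMS1991, Prop. 9.6]
[cite: McCallumLMS1991, §3 (3)] -/
theorem not_mem_torsionLocalKer_of_h1Eval_sq_ne_zero [W.IsElliptic] {n : ℕ} (hn : n ≠ 0)
    {𝔓₀ : Ideal (absIntegers (𝓞 K) K)} (h𝔓₀ : 𝔓₀ ∈ v.primesAbove) {γ : absoluteGaloisGroup K}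
    (hγ : IsArithFrobAt (𝓞 K) γ 𝔓₀) (hγγ : γ * γ ∈ torsionFixing W (n : ℤ))
    {x : galH1Torsion W (n : ℤ)} (hval : h1Eval W (n : ℤ) x (γ * γ) ≠ 0) :
    x ∉ W.torsionLocalKer (v.adicCompletion K) (n : ℤ) := by
  intro hxloc
  haveI : CharZero (v.adicCompletion K) :=
    charZero_of_injective_algebraMap (algebraMap K (v.adicCompletion K)).injective
  obtain ⟨𝔐, h𝔐⟩ := v.localPrimesAbove_nonempty
  set 𝔓w := v.primeBelow (closureEmb (K := K) (v.adicCompletion K)) 𝔐 with h𝔓w_def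
  have h𝔓w : 𝔓w ∈ v.primesAbove := v.primeBelow_mem_primesAbove h𝔐
  obtain ⟨δ, -, hF⟩ :=
    HeightOneSpectrum.exists_isArithFrobAt_conj_of_mem_primesAbove_holds h𝔓₀ h𝔓w hγ
  haveI : 𝔓w.IsPrime := h𝔓w.1
  have hFst := hF.mem_stabilizer
  have heq : (δ * γ * δ⁻¹) * (δ * γ * δ⁻¹) = δ * (γ * γ) * δ⁻¹ := by group
  have hFF : (δ * γ * δ⁻¹) * (δ * γ * δ⁻¹) ∈ 𝔓w.decompositionSubgroup (absoluteGaloisGroup K) :=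
    mul_mem hFst hFst
  have hFFT : (δ * γ * δ⁻¹) * (δ * γ * δ⁻¹) ∈ torsionFixing W (n : ℤ) := by
    rw [heq]; exact (torsionFixing_normal W _).conj_mem _ hγγ δ
  have hsurjv : Function.Surjective (torsionPointsMap W (v.adicCompletion K) (n : ℤ)) :=
    (torsionPointsMap_bijective W (v.adicCompletion K) hn).2
  have h0 := h1Eval_eq_zero_of_mem_torsionLocalKer W (n : ℤ) h𝔐 hFF hFFT hsurjv hxloc
  rw [heq, h1Eval_conj W _ x δ hγγ] at h0
  exact hval ((smul_eq_zero_iff_eq δ).mp h0)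

end Local

/-! ## §3 Over `ℚ`: the place `(ℓ)`, its completion `ℚ_ℓ`, Frobenius on roots of unity -/

section RatPlaces

variable {v : HeightOneSpectrum (𝓞 ℚ)}

/-- If the rational prime `ℓ` lies in the place `v` of `ℚ` and `ℓ ∤ m`, then `m ∉ v`. [folklore] -/
theorem natCast_not_mem_of_not_dvd {ℓ m : ℕ} (hℓ : ℓ.Prime) (hℓv : (ℓ : 𝓞 ℚ) ∈ v.asIdeal)
    (hm : ¬ ℓ ∣ m) : (m : 𝓞 ℚ) ∉ v.asIdeal := by
  intro hmv
  have hcop : Nat.Coprime ℓ m := (Nat.Prime.coprime_iff_not_dvd hℓ).mpr hm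
  obtain ⟨a, b, hab⟩ := Nat.isCoprime_iff_coprime.mpr hcop
  have h1 : (1 : 𝓞 ℚ) ∈ v.asIdeal := by
    have : ((a * ℓ + b * m : ℤ) : 𝓞 ℚ) ∈ v.asIdeal := by
      push_cast
      exact v.asIdeal.add_mem (v.asIdeal.mul_mem_left _ hℓv) (v.asIdeal.mul_mem_left _ hmv)
    rwa [hab, Int.cast_one] at this
  exact v.isPrime.ne_top ((Ideal.eq_top_iff_one _).mpr h1)

/-- **An arithmetic Frobenius at `𝔓 ∣ v ∤ m` raises `m`-th roots of unity to the `N v`-th power**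
(Mathlib `AlgHom.IsArithFrobAt.apply_of_pow_eq_one` in `\bar ℤ`; the tree's
`smul_eq_pow_residueCard_of_isArithFrobAt` is the case `m = ℓⁿ`). `χ_cyc(Frob_v) = N v`.
[cite: SerreAbelianLadic1968, Ch. I §1.2 (Example: the cyclotomic character)] -/
theorem smul_eq_pow_residueCard_of_isArithFrobAt_of_pow_eq_one {m : ℕ}
    (hm : (m : 𝓞 ℚ) ∉ v.asIdeal) {𝔓 : Ideal (absIntegers (𝓞 ℚ) ℚ)} (h𝔓 : 𝔓 ∈ v.primesAbove)
    {σ : absoluteGaloisGroup ℚ} (hσ : IsArithFrobAt (𝓞 ℚ) σ 𝔓) {t : AlgebraicClosure ℚ}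
    (ht : t ^ m = 1) : σ • t = t ^ v.residueCard := by
  haveI : 𝔓.IsPrime := h𝔓.1
  have hm0 : m ≠ 0 := by
    rintro rfl
    exact hm (by simp)
  have hti : _root_.IsIntegral (𝓞 ℚ) t :=
    IsIntegral.of_pow (Nat.pos_of_ne_zero hm0) (by rw [ht]; exact isIntegral_one)
  set x : absIntegers (𝓞 ℚ) ℚ := ⟨t, hti⟩ with hx
  have hxt : (x : AlgebraicClosure ℚ) = t := rfl
  have hxN : x ^ m = 1 := Subtype.ext (by simp [hxt, ht])
  have hm' : ((m : ℕ) : absIntegers (𝓞 ℚ) ℚ) ∉ 𝔓 := by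
    intro h
    apply hm
    rw [h𝔓.2.over, Ideal.mem_under, map_natCast]
    exact h
  have h := hσ.apply_of_pow_eq_one hxN hm'
  rw [MulSemiringAction.toAlgHom_apply, HeightOneSpectrum.card_quotient_under_eq_residueCard h𝔓]
    at h
  have h' := congrArg (fun z : absIntegers (𝓞 ℚ) ℚ => (z : AlgebraicClosure ℚ)) h
  simpa [hxt, integralClosure.coe_smul] using h'

/-- The rational prime generating a place `v ∋ ℓ` of `ℚ` (Mathlib `Rat.HeightOneSpectrum.primesEquiv`)
is `ℓ`. [folklore] -/
theorem primesEquiv_eq {ℓ : ℕ} (hℓ : ℓ.Prime) (hℓv : (ℓ : 𝓞 ℚ) ∈ v.asIdeal) :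
    ((Rat.HeightOneSpectrum.primesEquiv v : Nat.Primes) : ℕ) = ℓ := by
  have h1 : Rat.HeightOneSpectrum.natGenerator v ∣ ℓ := by
    rw [Rat.HeightOneSpectrum.natGenerator_dvd_iff]
    have := Ideal.mem_map_of_mem (Rat.IsIntegralClosure.intEquiv (𝓞 ℚ)) hℓv
    rwa [map_natCast] at this
  exact (Nat.prime_dvd_prime_iff_eq (Rat.HeightOneSpectrum.prime_natGenerator v) hℓ).mp h1

/-- **The strict local condition is invariant under a ring isomorphism of the local field onto
`ℚ_ℓ`**: for any `ℚ`-algebra field `E` with `θ : E ≃+* ℚ_[ℓ]` (e.g. Mathlib's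
`v.adicCompletion ℚ ≃A[ℚ] ℚ_[ℓ]`, `v = (ℓ)`), `ker (H¹(ℚ, E[n]) → H¹(ℚ_ℓ, E[n])) =
ker (H¹(ℚ, E[n]) → H¹(E, E[n]))` — the tree's `conjAct_mem_torsionLocalKer_iff` with `σ = 1`
(`1_* = id`, `conjAct_one`). The `Algebra ℚ E` structure is an implicit (not instance) binder so
that consumers may supply the adic completion with its own algebra structure.
[cite: GrossLMS1991, Prop. 8.2] -/
theorem mem_torsionLocalKer_padic_iff (W : WeierstrassCurve ℚ) {ℓ : ℕ} [Fact ℓ.Prime]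
    {E : Type} [Field E] {_ : Algebra ℚ E} [CharZero E] (θ : E ≃+* ℚ_[ℓ]) (n : ℤ)
    (x : galH1Torsion W n) :
    x ∈ W.torsionLocalKer ℚ_[ℓ] n ↔ x ∈ W.torsionLocalKer E n := by
  have h := Rank1Residual.X11b.Three.Koly.ZhangSupply.LocalConj.conjAct_mem_torsionLocalKer_iff
    (K := ℚ) W 1 θ (fun q ↦ by
      change θ (algebraMap ℚ _ q) = algebraMap ℚ _ q
      rw [eq_ratCast (algebraMap ℚ _) q, eq_ratCast (algebraMap ℚ _) q, map_ratCast]) n x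
  have h1 : @conjAct ℚ ℚ _ _ (@DivisionRing.toRatAlgebra ℚ _ _) W 1 n x = x :=
    DFunLike.congr_fun (@conjAct_one ℚ ℚ _ _ (@DivisionRing.toRatAlgebra ℚ _ _) W n) x
  rw [h1] at h
  exact h

end RatPlaces

end Summit.BirchSwinnertonDyer.BirchSwinnertonDyer.Theorems.GenusKolyTwistingPrime

end
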